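import Summits.CriticalPhenomena.PercolationContinuityZ3.Theorems.PercLowPointHalfSpaceBoundaryTwoArmDecayKTailReduction
import Summits.CriticalPhenomena.PercolationContinuityZ3.Theorems.PercLowPointHalfSpaceBoundaryTwoArmDecayInverseMultiplicityCensus

/-!
# Crux `PercLowPointHalfSpace.BoundaryTwoArmDecay` (stmt-CriticalPhenomena-0911), line
# `staircase-bootstrap-floor-decoupling` (lead c1): the HARMONIC form of the multiplicity input

The inverse-multiplicity census (`StubCensus.invMult_census`, p156328, UNCONDITIONAL) says that at `p_c(ℤ³)`, for every `n`,

  `∫_{A_n} (max 1 K_n)⁻¹ dP ≤ 2 e_n / p_c³`,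

`A_n = kissV n 0 1` (both `ℍ`-clusters of the adjacent floor roots `0, e` meet level `n` and are distinct), `K_n = |PK n 0 ω|` (partner-kiss
floor edges of `U = C_ℍ(0)`), `e_n` the exact-height density.  Hence the census needs NO truncation once each kiss configuration is
down-weighted by its multiplicity, and the whole new-conjecture content of the line is the statement that this weighting costs `n^{o(1)}`:

  `HarmonicKTail : ∀ s > 0, ∀ᶠ n, n^{-s} P(A_n) ≤ ∫_{A_n} (max 1 K_n)⁻¹ dP`

(equivalent to KTail up to `s ↦ 2s` by Markov both ways).  This file lands, as a registered sub-goal of the crux item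
(`stub_harmonicKTailReduction`, `--supports stmt-CriticalPhenomena-0911`), the glue a planner needs to use the harmonic form as the child:

  `HarmonicKTail → (SlabCrossover A for some A ∈ [1, 6/5)) → SubpolynomialBlocking → BoundaryTwoArmDecay`.

## Proof

`HarmonicKTail` at loss `s` and `invMult_census`: `P(A_n) ≤ (2/p_c³) n^{s} e_n` for large `n` (`HarmonicKTail.pointwise`); dyadic averaging
with the tall density at `t` (`stub_tallDensity` from `SubpolynomialBlocking`; `StubStep.even_bound`, `sum_exactDens_toReal_le`,
`decay_of_eventually`) gives the vertical exponent `3 - s - t` (`HarmonicKTail.aprioriV_of_harmonic`, `s = t = σ/2`); then the landed reach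
reduction `stub_reach` exactly as in `stub_kTailReduction` (`σ₀ = (6 - 5A)/16`, `b = 13/4 - 5A/8`, `κ = b - 5/2`).
-/

noncomputable section

namespace Summit.CriticalPhenomena.PercolationContinuityZ3.Theorems.BoundaryTwoArmDecay

open MeasureTheory
open scoped ENNReal
open Literature.Probability.Percolation Literature.Probability.LatticeModels

namespace HarmonicKTail

open Negative (μ)
open StubStep (kissV exactDens tallDens kissV_antitone_level sum_exactDens_toReal_le even_bound decay_of_eventually)
open StubCensus (PK eD kap invMult_census eD_ne_top)

/-- **One value of `n`.** From the harmonic input AT `n` with loss `s` and the inverse-multiplicity census: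
`P(A_n) ≤ (2/p_c³) · n^{s} · e_n`. -/
theorem pointwise {s : ℝ} {n : ℕ} (hn : 1 ≤ n)
    (hH : ENNReal.ofReal ((n : ℝ) ^ (-s)) * μ (kissV n 0 1) ≤
      ∫⁻ ω, (kissV n 0 1).indicator (fun ω => (((max 1 (PK n 0 ω).ncard : ℕ) : ℝ≥0∞))⁻¹) ω ∂μ) :
    μ.real (kissV n 0 1) ≤ 2 / (criticalProbI 3 : ℝ) ^ 3 * (n : ℝ) ^ s * (eD n).toReal := by
  have hnpos : (0 : ℝ) < n := by exact_mod_cast hn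
  have hp : 0 < (criticalProbI 3 : ℝ) := by
    rw [coe_criticalProbI]
    exact (Grimmett1999_criticalProb_pos_lt_one_holds 3 (by norm_num)).1
  have hp3 : 0 < (criticalProbI 3 : ℝ) ^ 3 := pow_pos hp 3
  have hns : 0 < (n : ℝ) ^ (-s) := Real.rpow_pos_of_pos hnpos _
  -- the chain in `ℝ≥0∞`: `ofReal(n^{-s}) · P(A_n) ≤ 2 e_n / ofReal(p³)`
  have hchain : ENNReal.ofReal ((n : ℝ) ^ (-s)) * μ (kissV n 0 1) ≤
      (2 * eD n) / ENNReal.ofReal ((criticalProbI 3 : ℝ) ^ 3) := hH.trans (invMult_census n)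
  have hc0 : ENNReal.ofReal ((n : ℝ) ^ (-s)) ≠ 0 := (ENNReal.ofReal_pos.2 hns).ne'
  have hctop : ENNReal.ofReal ((n : ℝ) ^ (-s)) ≠ ⊤ := ENNReal.ofReal_ne_top
  have hBtop : (2 * eD n) / ENNReal.ofReal ((criticalProbI 3 : ℝ) ^ 3) ≠ ⊤ :=
    (ENNReal.div_lt_top (ENNReal.mul_ne_top ENNReal.ofNat_ne_top (eD_ne_top n))
      (ENNReal.ofReal_pos.2 hp3).ne').ne
  -- divide by `ofReal(n^{-s})`
  have hdiv : μ (kissV n 0 1) ≤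
      ((2 * eD n) / ENNReal.ofReal ((criticalProbI 3 : ℝ) ^ 3)) / ENNReal.ofReal ((n : ℝ) ^ (-s)) := by
    rw [ENNReal.le_div_iff_mul_le (Or.inl hc0) (Or.inl hctop), mul_comm]
    exact hchain
  -- pass to real numbers
  have hfin : ((2 * eD n) / ENNReal.ofReal ((criticalProbI 3 : ℝ) ^ 3)) / ENNReal.ofReal ((n : ℝ) ^ (-s)) ≠ ⊤ :=
    (ENNReal.div_lt_top hBtop hc0).ne
  rw [measureReal_def]
  calc (μ (kissV n 0 1)).toReal
      ≤ (((2 * eD n) / ENNReal.ofReal ((criticalProbI 3 : ℝ) ^ 3)) / ENNReal.ofReal ((n : ℝ) ^ (-s))).toReal :=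
        ENNReal.toReal_mono hfin hdiv
    _ = 2 / (criticalProbI 3 : ℝ) ^ 3 * (n : ℝ) ^ s * (eD n).toReal := by
        rw [ENNReal.toReal_div, ENNReal.toReal_div, ENNReal.toReal_mul, ENNReal.toReal_ofReal hp3.le,
          ENNReal.toReal_ofReal hns.le, ENNReal.toReal_ofNat, Real.rpow_neg hnpos.le]
        field_simp

/-- **The direct step from the harmonic input.** The tall-density bound (all exponents) and `HarmonicKTail` give
`AprioriV (3 - σ)` for every `σ > 0` (`s = t = σ/2`). -/
theorem aprioriV_of_harmonic
    (hTall : ∀ t : ℝ, 0 < t → ∃ C : ℝ, ∀ n : ℕ, 1 ≤ n → tallDens n ≤ ENNReal.ofReal (C * (n : ℝ) ^ (t - 2)))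
    (hH : ∀ s : ℝ, 0 < s → ∀ᶠ n : ℕ in Filter.atTop,
      ENNReal.ofReal ((n : ℝ) ^ (-s)) * μ (kissV n 0 1) ≤
        ∫⁻ ω, (kissV n 0 1).indicator (fun ω => (((max 1 (PK n 0 ω).ncard : ℕ) : ℝ≥0∞))⁻¹) ω ∂μ)
    {σ : ℝ} (hσ : 0 < σ) :
    ∃ C : ℝ, ∀ n : ℕ, 1 ≤ n → μ.real (kissV n 0 1) ≤ C * (n : ℝ) ^ (-(3 - σ)) := by
  have hσ2 : 0 < σ / 2 := by positivity
  obtain ⟨Ct, hCt⟩ := hTall (σ / 2) hσ2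
  obtain ⟨N₀, hN₀⟩ := Filter.eventually_atTop.1 (hH (σ / 2) hσ2)
  have hC₂0 : (0 : ℝ) ≤ 2 / (criticalProbI 3 : ℝ) ^ 3 := by
    have hp : 0 < (criticalProbI 3 : ℝ) := by
      rw [coe_criticalProbI]
      exact (Grimmett1999_criticalProb_pos_lt_one_holds 3 (by norm_num)).1
    positivity
  -- the bound at every `n ≥ max N₀ 1` (`exactDens = eD` definitionally)
  have hstep : ∀ n : ℕ, max N₀ 1 ≤ n →
      μ.real (kissV n 0 1) ≤ 2 / (criticalProbI 3 : ℝ) ^ 3 * (n : ℝ) ^ (σ / 2) * (exactDens n).toReal :=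
    fun n hn => pointwise (le_of_max_le_right hn) (hN₀ n (le_of_max_le_left hn))
  -- dyadic averaging
  have hanti : ∀ m m' : ℕ, m ≤ m' → μ.real (kissV m' 0 1) ≤ μ.real (kissV m 0 1) :=
    fun m m' h => measureReal_mono (kissV_antitone_level h 0 1)
  have hsum : ∀ N : ℕ, 1 ≤ N →
      ∑ m ∈ Finset.Icc N (2 * N), (exactDens m).toReal ≤ max Ct 0 * (N : ℝ) ^ (σ / 2 - 2) :=
    fun N hN => sum_exactDens_toReal_le (hCt N hN)
  have heven : ∀ N : ℕ, max N₀ 1 ≤ N →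
      μ.real (kissV (2 * N) 0 1) ≤
        2 / (criticalProbI 3 : ℝ) ^ 3 * (2 : ℝ) ^ (σ / 2) * max Ct 0 * (N : ℝ) ^ (-(3 - σ)) := by
    intro N hN
    have hN1 : 1 ≤ N := le_of_max_le_right hN
    have h := even_bound (f := fun m => μ.real (kissV m 0 1)) (e := fun m => (exactDens m).toReal)
      hσ2.le hC₂0 (le_max_right Ct 0) (fun _ => ENNReal.toReal_nonneg) hanti hstep (hsum N hN1) hN hN1
    have hexp : σ / 2 + σ / 2 - 3 = -(3 - σ) := by ring
    rw [hexp] at h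
    exact h
  exact decay_of_eventually (f := fun m => μ.real (kissV m 0 1)) (le_max_right N₀ 1)
    (fun _ => measureReal_le_one) hanti heven

end HarmonicKTail

open HarmonicKTail StubStep Negative in
/-- **Conditional reduction of crux A to the HARMONIC multiplicity input** (registered sub-goal `stub_harmonicKTailReduction`
of stmt-CriticalPhenomena-0911, line `staircase-bootstrap-floor-decoupling`, lead c1): `HarmonicKTail` (for every `s > 0`,
eventually `n^{-s} P(A_n) ≤ ∫_{A_n} (max 1 K_n)⁻¹ dP`), a polynomial slab crossover with exponent `A ∈ [1, 6/5)` (stmt-6700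
strengthened) and the tagged sibling crux `SubpolynomialBlocking` (stmt-4446) imply `BoundaryTwoArmDecay`.  Proof: the
UNCONDITIONAL inverse-multiplicity census (`StubCensus.invMult_census`, p156328), the landed tall density (`stub_tallDensity`),
dyadic averaging (`HarmonicKTail.aprioriV_of_harmonic` at `σ = 3σ₀`, `σ₀ = (6 - 5A)/16`), and the landed `stub_reach`
(`b = 13/4 - 5A/8`, `κ = b - 5/2`). -/
theorem stub_harmonicKTailReduction :
    (∀ s : ℝ, 0 < s → ∀ᶠ n : ℕ in Filter.atTop,
      ENNReal.ofReal ((n : ℝ) ^ (-s)) *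
          (bondPercolation (zdGraph 3) (criticalProbI 3))
            {ω | (∃ y : Site 3, (n : ℤ) ≤ y 0 ∧ ω ∈ openConnIn (halfSpace 3) 0 y) ∧
              (∃ y : Site 3, (n : ℤ) ≤ y 0 ∧ ω ∈ openConnIn (halfSpace 3) ((0 : Site 3) + Pi.single 1 1) y) ∧
              ω ∉ openConnIn (halfSpace 3) 0 ((0 : Site 3) + Pi.single 1 1)} ≤
        ∫⁻ ω, {ω : BondConfig (Site 3) | (∃ y : Site 3, (n : ℤ) ≤ y 0 ∧ ω ∈ openConnIn (halfSpace 3) 0 y) ∧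
              (∃ y : Site 3, (n : ℤ) ≤ y 0 ∧ ω ∈ openConnIn (halfSpace 3) ((0 : Site 3) + Pi.single 1 1) y) ∧
              ω ∉ openConnIn (halfSpace 3) 0 ((0 : Site 3) + Pi.single 1 1)}.indicator
            (fun ω => (((max 1 {q : Site 3 × Site 3 | q.1 0 = 0 ∧ q.2 0 = 0 ∧ (zdGraph 3).Adj q.1 q.2 ∧
                ω ∈ openConnIn (halfSpace 3) 0 q.1 ∧ ω ∉ openConnIn (halfSpace 3) 0 q.2 ∧
                ∃ y : Site 3, (n : ℤ) ≤ y 0 ∧ ω ∈ openConnIn (halfSpace 3) q.2 y}.ncard : ℕ) : ENNReal))⁻¹) ω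
            ∂(bondPercolation (zdGraph 3) (criticalProbI 3))) →
    (∃ A : ℝ, 1 ≤ A ∧ A < 6 / 5 ∧ ∃ C : ℝ, 0 < C ∧ ∀ k n : ℕ, 1 ≤ k → ∀ x : Site 3,
      (bondPercolation (zdGraph 3) (criticalProbI 3)).real
          {ω | ∃ y : Site 3, (n : ℤ) ≤ max |y 1 - x 1| |y 2 - x 2| ∧
            ω ∈ openConnIn {z : Site 3 | |z 0| ≤ (k : ℤ)} x y} ≤
        C * (k : ℝ) ^ C * Real.exp (-((n : ℝ) / (C * (k : ℝ) ^ A)))) →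
    Summit.CriticalPhenomena.PercolationContinuityZ3.Theses.PercNonProliferation.SubpolynomialBlocking →
      Summit.CriticalPhenomena.PercolationContinuityZ3.Theses.PercLowPointHalfSpace.BoundaryTwoArmDecay := by
  intro hH hSlab hB
  -- the slab exponent A ∈ [1, 6/5) fixes the losses
  obtain ⟨A, hA1, hA65, hSlabA⟩ := hSlab
  set σ : ℝ := (6 - 5 * A) / 16 with hσdef
  have hσ : 0 < σ := by rw [hσdef]; linarith
  -- harmonic input + inverse-multiplicity census + tall density: vertical exponent 3 - 3σ
  have hV : ∃ C : ℝ, ∀ n : ℕ, 1 ≤ n → μ.real (kissV n 0 1) ≤ C * (n : ℝ) ^ (-(3 - 3 * σ)) :=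
    aprioriV_of_harmonic (stub_tallDensity hB) hH (by positivity : (0 : ℝ) < 3 * σ)
  -- reach: sup exponent b = 13/4 - 5A/8 > 5/2, admissible since bA < 3 - 3σ ⟺ (6/5 - A)(5/2 - A) > 0
  set b : ℝ := 13 / 4 - 5 * A / 8 with hbdef
  have hb52 : (5 : ℝ) / 2 < b := by rw [hbdef]; linarith
  have hb : 0 < b := by linarith
  have hbA : b * A < 3 - 3 * σ := by
    rw [hbdef, hσdef]
    nlinarith [mul_pos (sub_pos.2 hA65) (sub_pos.2 (show A < 5 / 2 by linarith))]
  obtain ⟨C, hC⟩ := stub_reach A hA1 hSlabA (3 - 3 * σ) b hb hbA hV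
  -- κ = b - 5/2
  rw [boundaryTwoArmDecay_iff]
  refine ⟨b - 5 / 2, C, by linarith, fun r hr => ?_⟩
  have hexp : (-(5 / 2 + (b - 5 / 2)) : ℝ) = -b := by ring
  rw [hexp]
  exact hC r hr

end Summit.CriticalPhenomena.PercolationContinuityZ3.Theorems.BoundaryTwoArmDecay

end
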